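import Summits.CriticalPhenomena.PercolationContinuityZ3.Theorems.Transplant.KNCellsBoxProdZ2RootRun
import Summits.CriticalPhenomena.PercolationContinuityZ3.Theorems.Transplant.PlanarCells2Contain
import HarnessLib

/-!
# (R) under D″, planar part: the ROOT RUN over the TWO-UNIT cells — record-agnostic containments of signed boxes about the root centre in
# `BtwN 0 du ∪ Q (0 + du)`, off `Q 0`, and in `M (0 + du)` (run-axis unit `r∥ = P.r du.1` for levels, transverse unit `r⊥ = P.r (oth du.1)`),
# with the one-unit `Adv` straight run as the worked special case (twin of p2's `KNCellsBoxProdZ2RootRun`; DPRIME-SCOPE §2 L6′ (R), p2 column)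

builds on p205010 (kernel theorem, internal audit signed; external expert review pending) — nothing in this file uses p205010.
Lane `prim-bschramm-*`, seat `prim-bschramm-p2` (gen 7; (R) = p2 lineage by authorship); helper file (`--supports stmt-CriticalPhenomena-4575 --as helper`).
Pure `Site 2` geometry over hp-8's `PCells2`.

WHY RECORD-AGNOSTIC.  The D″ root residue (U6′) runs its seed chain from the first-hop row above the wired root cube `Q 0` through the narrow
between-box `BtwN 0 du` into the child's cube, ending on a face inside `M (0 + du)` — exactly as the one-unit run — but its chain record (LEVEL 1:
`WinBandChain` / p1-g9's planar `Band`, variable extents, band-rectangle kits) is being typed elsewhere.  Every such record places its regions inside a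
signed PRISM `sBox du.1 (sgOf du) (rootCtr du ca cb) lo hi ρ` and its far face inside a degenerate signed box; so the three planar facts the residue
needs are stated here for ARBITRARY signed boxes about `rootCtr du ca cb` (level `ca` along `du`, transverse `cb`), with the two units appearing only in
the admissibility inequalities, and then specialised to `Adv.region / Adv.core` (the one-unit schedule, any `N`) as the regression / special case.
* §1 `sBox_rootCtr_subset_BtwN_union_Q` (`5 r∥ + 1 ≤ ca + lo`, `ca + hi ≤ 25 r∥`, `|cb| + w ≤ 5 r⊥ − 1`), `sBox_rootCtr_disjoint_Q_zero` (`5 r∥ + 1 ≤ ca + lo`),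
  `sBox_rootCtr_subset_M` (`17 r∥ ≤ ca + lo`, `ca + hi ≤ 23 r∥`, `|cb| + w ≤ 3 r⊥`);
* §2 the `Adv` schedule: `RootRunOK₂ P du t R' ℓ₀ N ca cb q' ρ` (run unit `r∥ = 4t`, transverse bounds against `r⊥`), `rootRun₂_advOK`,
  **`rootRun₂_region_subset`**, **`rootRun₂_region_disjoint_Q`**, **`rootRun₂_last_subset_M`**.
[cite: KozmaNitzan2024, §4 p. 26 (E_{v,x}, M_v), p. 28 ((32) at the root), Lemma 11 (pp. 22–23)]
-/

noncomputable section

namespace Summit.CriticalPhenomena.PercolationContinuityZ3.Theorems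

namespace Transplant

namespace RootRun2

open Literature.Probability.Percolation Literature.Probability.LatticeModels
open Literature.Probability.Percolation.KozmaNitzan
open Literature.Probability.Percolation.KozmaNitzan.Cells (oth oth_ne eq_oth_of_ne sgOf sgOf_sign stepVec_apply_fst stepVec_apply_oth)
open ChainPlanar
open BoxProdZ2 (rootCtr rootCtr_fst rootCtr_oth sg_mul_sub)

variable (P : PCells2) (du : MDir) (ca cb : ℤ)

/-! ## §1 Signed boxes about the root centre versus the two-unit cells -/

/-- The centre of the child's cube: `20 r∥ σ` along the run axis, `0` across. [folklore] -/
theorem cen_stepVec (i : Fin 2) : P.cen ((0 : Site 2) + stepVec du) i = if i = du.1 then 20 * (P.r du.1 : ℤ) * sgOf du else 0 := by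
  rw [zero_add, PCells2.cen_apply]
  by_cases hi : i = du.1
  · subst hi; rw [if_pos rfl, stepVec_apply_fst]
  · rw [if_neg hi, eq_oth_of_ne hi, stepVec_apply_oth, mul_zero]

/-- **A signed box about the root centre lies in `BtwN 0 du ∪ Q (0 + du)`** when its levels lie in `[5 r∥ + 1, 25 r∥]` and its transverse extent
within `5 r⊥ − 1` of the axis. [cite: KozmaNitzan2024, §4 p. 26 (E_{v,x})] -/
theorem sBox_rootCtr_subset_BtwN_union_Q {lo hi w : ℤ} (hlo : 5 * (P.r du.1 : ℤ) + 1 ≤ ca + lo) (hhi : ca + hi ≤ 25 * (P.r du.1 : ℤ))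
    (hw : |cb| + w ≤ 5 * (P.r (oth du.1) : ℤ) - 1) :
    sBox du.1 (sgOf du) (rootCtr du ca cb) lo hi w ⊆ P.BtwN 0 du ∪ P.Q ((0 : Site 2) + stepVec du) := by
  intro x hx
  rw [PCells.mem_psBox_iff] at hx
  simp only [rootCtr_fst, rootCtr_oth, sg_mul_sub] at hx
  obtain ⟨⟨hl1, hl2⟩, hb1, hb2⟩ := hx
  have hcb := le_abs_self cb
  have hcb' := neg_abs_le cb
  by_cases hL : sgOf du * x du.1 ≤ 15 * (P.r du.1 : ℤ) - 1
  · -- the narrow between-box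
    refine Finset.mem_union_left _ ?_
    rw [PCells2.BtwN, PCells.mem_psBox_iff]
    simp only [PCells2.cen_zero, Pi.zero_apply, sub_zero]
    refine ⟨⟨by linarith, hL⟩, by linarith, by linarith⟩
  · -- the child's cube
    refine Finset.mem_union_right _ ?_
    rw [PCells2.Q, PCells2.mem_abox_iff]
    intro i
    rw [cen_stepVec]
    by_cases hi : i = du.1
    · subst hi
      rw [if_pos rfl]
      push_cast
      rcases sgOf_sign du with hs | hs
      · rw [hs] at hL hl1 hl2 ⊢
        simp only [one_mul, mul_one] at hL hl1 hl2 ⊢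
        constructor <;> linarith
      · rw [hs] at hL hl1 hl2 ⊢
        constructor <;> linarith
    · rw [if_neg hi, eq_oth_of_ne hi]
      push_cast
      constructor <;> linarith

/-- **A signed box about the root centre with levels above `5 r∥` misses the root cube `Q 0`.** [cite: KozmaNitzan2024, §4 p. 28] -/
theorem sBox_rootCtr_disjoint_Q_zero {lo hi w : ℤ} (hlo : 5 * (P.r du.1 : ℤ) + 1 ≤ ca + lo) :
    Disjoint (sBox du.1 (sgOf du) (rootCtr du ca cb) lo hi w) (P.Q 0) := by
  rw [Finset.disjoint_left]
  intro x hx hxQ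
  rw [PCells.mem_psBox_iff] at hx
  simp only [rootCtr_fst, rootCtr_oth, sg_mul_sub] at hx
  obtain ⟨⟨hl1, -⟩, -, -⟩ := hx
  rw [PCells2.Q, PCells2.mem_abox_iff] at hxQ
  obtain ⟨h1, h2⟩ := hxQ du.1
  simp only [PCells2.cen_zero, Pi.zero_apply] at h1 h2
  push_cast at h1 h2
  rcases sgOf_sign du with hs | hs <;> rw [hs] at hl1 <;> linarith

/-- **A signed box about the root centre lies in the child's target cube `M (0 + du)`** when its levels lie in `[17 r∥, 23 r∥]` and its transverse
extent within `3 r⊥` of the axis. [cite: KozmaNitzan2024, §4 p. 26 (M_v)] -/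
theorem sBox_rootCtr_subset_M {lo hi w : ℤ} (hlo : 17 * (P.r du.1 : ℤ) ≤ ca + lo) (hhi : ca + hi ≤ 23 * (P.r du.1 : ℤ))
    (hw : |cb| + w ≤ 3 * (P.r (oth du.1) : ℤ)) :
    sBox du.1 (sgOf du) (rootCtr du ca cb) lo hi w ⊆ P.M ((0 : Site 2) + stepVec du) := by
  intro x hx
  rw [PCells.mem_psBox_iff] at hx
  simp only [rootCtr_fst, rootCtr_oth, sg_mul_sub] at hx
  obtain ⟨⟨hl1, hl2⟩, hb1, hb2⟩ := hx
  have hcb := le_abs_self cb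
  have hcb' := neg_abs_le cb
  rw [PCells2.M, PCells2.mem_abox_iff]
  intro i
  rw [cen_stepVec]
  by_cases hi : i = du.1
  · subst hi
    rw [if_pos rfl]
    push_cast
    rcases sgOf_sign du with hs | hs
    · rw [hs] at hl1 hl2 ⊢
      simp only [one_mul, mul_one] at hl1 hl2 ⊢
      constructor <;> linarith
    · rw [hs] at hl1 hl2 ⊢
      constructor <;> linarith
  · rw [if_neg hi, eq_oth_of_ne hi]
    push_cast
    constructor <;> linarith

/-! ## §2 The one-unit `Adv` schedule as the worked case: admissible parameters against the two units -/

/-- **Admissible parameters of the two-unit root run with the `Adv` schedule** (`N` advance steps of length `t = r∥ / 4`, start row of half-width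
`q'` at level `ca`, transverse offset `cb`, region half-width `ρ`): the one-unit `RootRunOK` with the transverse bounds measured in `r⊥` and `ρ`,
`N` free (the chain record supplies its own lower bounds on `ρ`). [this work] -/
structure RootRunOK₂ (P : PCells2) (du : MDir) (t R' ℓ₀ N : ℕ) (ca cb q' ρ : ℤ) : Prop where
  /-- the run unit -/
  hr : (P.r du.1 : ℤ) = 4 * t
  /-- route scales fit in one advance -/
  hs : (R' : ℤ) + ℓ₀ ≤ t
  /-- the neighbourhood radius is small -/
  hs2 : 2 * (R' : ℤ) ≤ t
  /-- the start row has a nonnegative half-width -/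
  hq' : 0 ≤ q'
  /-- `AdvOK`'s lower bounds on the region half-width -/
  hρ0 : (t : ℤ) + 2 * R' ≤ ρ
  /-- `AdvOK`'s lower bounds on the region half-width -/
  hρ : q' + 2 * t + ((N : ℤ) + 3) * R' ≤ ρ
  /-- region `0` stays above the wired root cube: `5 r∥ + 1 ≤ ca − ρ` -/
  hlo : 20 * (t : ℤ) + 1 + ρ ≤ ca
  /-- the run stays inside the child's cube: `ca + (N+1) t ≤ 25 r∥` -/
  hhi : ca + ((N : ℤ) + 1) * t ≤ 100 * t
  /-- the far face reaches `M (0 + du)`: `17 r∥ ≤ ca + (N+1) t` -/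
  hloM : 68 * (t : ℤ) ≤ ca + ((N : ℤ) + 1) * t
  /-- the far face stays inside `M (0 + du)`: `ca + (N+1) t ≤ 23 r∥` -/
  hhiM : ca + ((N : ℤ) + 1) * t ≤ 92 * t
  /-- the regions stay inside the narrow between-box transversally -/
  htr : |cb| + ρ ≤ 5 * (P.r (oth du.1) : ℤ) - 1
  /-- the far face stays inside `M (0 + du)` transversally -/
  htrM : |cb| + Adv.w₁ 0 q' t R' + (N : ℤ) * R' ≤ 3 * (P.r (oth du.1) : ℤ)

variable {P du} {t R' ℓ₀ N : ℕ} {ca cb q' ρ : ℤ} (h : RootRunOK₂ P du t R' ℓ₀ N ca cb q' ρ)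
include h

/-- The parameters are `AdvOK`. [folklore] -/
theorem rootRun₂_advOK : Adv.AdvOK 0 q' t ρ R' ℓ₀ N where
  hq := le_rfl
  hq' := h.hq'
  hs := h.hs
  hs2 := h.hs2
  hρ0 := by have := h.hρ0; linarith
  hρ := by have := h.hρ; linarith

/-- **Every region of the two-unit root run lies in `BtwN 0 du ∪ Q (0 + du)`** (`k ≤ N`). [cite: KozmaNitzan2024, §4 p. 26, Lemma 11 (p. 22: Ω)] -/
theorem rootRun₂_region_subset {k : ℕ} (hk : k ≤ N) :
    Adv.region 0 (t : ℤ) ρ du.1 (sgOf du) (rootCtr du ca cb) k ⊆ P.BtwN 0 du ∪ P.Q ((0 : Site 2) + stepVec du) := by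
  refine (Adv.region_subset_prism (sgOf_sign du) (rootCtr du ca cb) (rootRun₂_advOK h) hk).trans ?_
  have hr := h.hr; have hlo := h.hlo; have hhi := h.hhi; have htr := h.htr
  exact sBox_rootCtr_subset_BtwN_union_Q P du ca cb (by linarith) (by linarith) htr

/-- **Every region of the two-unit root run is off the root cube `Q 0`** (`k ≤ N`). [cite: KozmaNitzan2024, §4 p. 28] -/
theorem rootRun₂_region_disjoint_Q {k : ℕ} (hk : k ≤ N) :
    Disjoint (Adv.region 0 (t : ℤ) ρ du.1 (sgOf du) (rootCtr du ca cb) k) (P.Q 0) := by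
  refine Finset.disjoint_of_subset_left (Adv.region_subset_prism (sgOf_sign du) (rootCtr du ca cb) (rootRun₂_advOK h) hk) ?_
  have hr := h.hr; have hlo := h.hlo
  exact sBox_rootCtr_disjoint_Q_zero P du ca cb (hi := 0 + ((N : ℤ) + 1) * t) (w := ρ) (by linarith)

/-- **The far face of the two-unit root run lies in `M (0 + du)`.** [cite: KozmaNitzan2024, §4 p. 26 (M_v)] -/
theorem rootRun₂_last_subset_M :
    Adv.core 0 q' (t : ℤ) R' du.1 (sgOf du) (rootCtr du ca cb) (N + 1) ⊆ P.M ((0 : Site 2) + stepVec du) := by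
  rw [(Adv.core_zero_last (q := (0 : ℤ)) (q' := q') (s₁ := (t : ℤ)) (R' := R') (N := N) (a := du.1) (σ := sgOf du) (c := rootCtr du ca cb)).2]
  have hr := h.hr; have hloM := h.hloM; have hhiM := h.hhiM; have htrM := h.htrM
  exact sBox_rootCtr_subset_M P du ca cb (by linarith) (by linarith) (by linarith)

end RootRun2

end Transplant

end Summit.CriticalPhenomena.PercolationContinuityZ3.Theorems

end
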